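import Mathlib
import Summits.CriticalPhenomena.CardyFormulaZ2.Theorems.CardySelfRefinementDefs
import Summits.CriticalPhenomena.CardyFormulaZ2.Theorems.CardySelfRefinementTrivialSectorRateStubLocalEngineRotation
import Summits.CriticalPhenomena.CardyFormulaZ2.Theorems.CardySelfRefinementTrivialSectorRateStubRussoOrbit
import Literature.Probability.Percolation.SelfRefinementMeasure
import Literature.NumberTheory.Transcendental.NesterenkoBricksPadic
import HarnessLib

/-!
# Stub `stub_localEngine` of line `far-field-is-a-quarter-turn` (crux `TrivialSectorRate`,
stmt-CriticalPhenomena-10266): the quarter turn on the COIN side — the `C₄(u)`-orbits and the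
invariance of the orbit sums

Companion of `…TrivialSectorRateStubLocalEngineRotation.lean` (intertwined pairs `(g, σ)`:
`g '' (cfg k S) = cfg k (σ ⁻¹' S)`, `σ` bias-preserving; the quarter turn `g` about
`ctr k u = k•u` and its coin permutation `σ`, pinned down by their formulas; `infl_pullback_eq`).

* Formulas of the inverses (`quarterTurn_symm_apply`, `quarterTurn_coin_symm_apply_zero/_ne_zero`:
  `σ⁻¹` carries the own coin of an edge to the own coin of its IMAGE edge and the coins of a bundle
  to those of its image bundle).
* **`σ` permutes the `C₄(u)`-orbits**: the shared and selector coins of the four bundles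
  `bundlesAt u` (`quarterTurn_coin_bundlesAt`, `sum_bundlesAt_quarterTurn_coin[_symm]`) and the own
  coins of the interior edges of the four cells `cellsAt u` (`image_quarterTurn_interior`,
  `sum_interiorEdges_quarterTurn_coin[_symm]`; an interior edge of the cell `t` goes to an interior
  edge of the rotated cell `(t₁ − u₁ + u₀, u₀ + u₁ − t₀ − 1)`, `tb_quarterTurn_edge`).
* **Consequently the orbit sums of the influences are `C₄(u)`-invariant**: the `Tρ`-type sum over
  `bundlesAt u` and the `Tc`-type double sum over the interior edges of `cellsAt u` of the signed
  influences on the coin event of the rotated event `{ω | g '' ω ∈ B}` equal those on the coin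
  event of `B`, for ANY event `B` (`bundleSum_infl_quarterTurn`, `cellSum_infl_quarterTurn` —
  registered; general intertwined forms `bundleSum_infl_pullback`, `cellSum_infl_pullback`).
-/

noncomputable section

namespace Summit.CriticalPhenomena.CardyFormulaZ2.Theorems.CardySelfRefinement.FarField

open Set MeasureTheory
open Literature.Probability.LatticeModels Literature.Probability.Percolation
open Literature.Probability.Percolation.QuadCrossing
open Summit.CriticalPhenomena.CardyFormulaZ2.Theses.CardySelfRefinement

/-! ### Formulas -/

/-- The inverse quarter turn: `g⁻¹ x = (x₁ − c₁ + c₀, c₀ + c₁ − x₀)`. -/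
theorem quarterTurn_symm_apply {k : ℕ} {u : Site 2} (g : Site 2 ≃ Site 2)
    (hg : ∀ x, g x = ![ctr k u 0 + ctr k u 1 - x 1, x 0 - ctr k u 0 + ctr k u 1]) (x : Site 2) :
    g.symm x = ![x 1 - ctr k u 1 + ctr k u 0, ctr k u 0 + ctr k u 1 - x 0] := by
  rw [Equiv.symm_apply_eq, hg]
  funext i
  fin_cases i <;> simp

/-- The inverse coin permutation on own coins: `σ⁻¹ (v,d,0)` is the own coin of the IMAGE edge
`g {v, v + e_d}`, namely `((c₀ + c₁ − v₁ − [d = 1], v₀ − c₀ + c₁), 1 − d, 0)`. -/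
theorem quarterTurn_coin_symm_apply_zero {k : ℕ} {u : Site 2} (σ : Coin ≃ Coin)
    (h0 : ∀ (v : Site 2) (d : Fin 2), σ (v, d, 0) =
      (![v 1 - ctr k u 1 + ctr k u 0, ctr k u 0 + ctr k u 1 - v 0 - (if d = 0 then 1 else 0)],
        Equiv.swap 0 1 d, 0)) (v : Site 2) (d : Fin 2) :
    σ.symm (v, d, 0) =
      (![ctr k u 0 + ctr k u 1 - v 1 - (if d = 1 then 1 else 0), v 0 - ctr k u 0 + ctr k u 1],
        Equiv.swap 0 1 d, 0) := by
  rw [Equiv.symm_apply_eq, h0]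
  simp only [Prod.mk.injEq]
  refine ⟨?_, ?_, trivial⟩
  · funext i
    fin_cases i <;> fin_cases d <;> simp
    ring
  · fin_cases d <;> rfl

/-- The inverse coin permutation on shared coins and selectors: `σ⁻¹ (t,d,j)` is the same coin of
the IMAGE bundle, `((u₀ + u₁ − t₁ − [d = 1], t₀ − u₀ + u₁), 1 − d, j)`. -/
theorem quarterTurn_coin_symm_apply_ne_zero {u : Site 2} (σ : Coin ≃ Coin)
    (h : ∀ (t : Site 2) (d : Fin 2) (j : Fin 3), j ≠ 0 → σ (t, d, j) =
      (![t 1 - u 1 + u 0, u 0 + u 1 - t 0 - (if d = 0 then 1 else 0)], Equiv.swap 0 1 d, j))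
    (t : Site 2) (d : Fin 2) {j : Fin 3} (hj : j ≠ 0) :
    σ.symm (t, d, j) =
      (![u 0 + u 1 - t 1 - (if d = 1 then 1 else 0), t 0 - u 0 + u 1], Equiv.swap 0 1 d, j) := by
  rw [Equiv.symm_apply_eq, h _ _ _ hj]
  simp only [Prod.mk.injEq]
  refine ⟨?_, ?_, trivial⟩
  · funext i
    fin_cases i <;> fin_cases d <;> simp
    ring
  · fin_cases d <;> rfl

/-! ### The coin permutation of the quarter turn permutes the bundles at `u` -/

/-- The shared / selector coins of the four bundles at `u` are permuted cyclically by the coin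
permutation of the quarter turn about `k•u` (in the labels of `bundlesAt u`: `(u,0) ↦ (u−e₁,1)`,
`(u−e₁,1) ↦ (u−e₀,0)`, `(u−e₀,0) ↦ (u,1)`, `(u,1) ↦ (u,0)`). -/
theorem quarterTurn_coin_bundlesAt (u : Site 2) (σ : Coin ≃ Coin)
    (h : ∀ (t : Site 2) (d : Fin 2) (j : Fin 3), j ≠ 0 → σ (t, d, j) =
      (![t 1 - u 1 + u 0, u 0 + u 1 - t 0 - (if d = 0 then 1 else 0)], Equiv.swap 0 1 d, j))
    {j : Fin 3} (hj : j ≠ 0) :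
    σ (u, 0, j) = (u - Pi.single 1 1, 1, j) ∧ σ (u, 1, j) = (u, 0, j) ∧
      σ (u - Pi.single 0 1, 0, j) = (u, 1, j) ∧
      σ (u - Pi.single 1 1, 1, j) = (u - Pi.single 0 1, 0, j) := by
  refine ⟨?_, ?_, ?_, ?_⟩
  all_goals
    rw [h _ _ _ hj, Prod.mk.injEq, Prod.mk.injEq]
    refine ⟨funext fun i => ?_, by simp, rfl⟩
    fin_cases i <;>
      simp only [Fin.isValue, Fin.zero_eta, Fin.mk_one, Matrix.cons_val_zero, Matrix.cons_val_one,
        Matrix.cons_val_fin_one, Pi.sub_apply, Pi.single_apply, one_ne_zero, zero_ne_one,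
        ↓reduceIte] <;> omega

/-- **Sums over the bundle orbit are invariant under the coin permutation of the quarter turn**
(layers `j = 1, 2`: shared coins, selectors). -/
theorem sum_bundlesAt_quarterTurn_coin (u : Site 2) (σ : Coin ≃ Coin)
    (h : ∀ (t : Site 2) (d : Fin 2) (j : Fin 3), j ≠ 0 → σ (t, d, j) =
      (![t 1 - u 1 + u 0, u 0 + u 1 - t 0 - (if d = 0 then 1 else 0)], Equiv.swap 0 1 d, j))
    {j : Fin 3} (hj : j ≠ 0) (f : Coin → ℝ) :
    ∑ b ∈ bundlesAt u, f (σ (b.1, b.2, j)) = ∑ b ∈ bundlesAt u, f (b.1, b.2, j) := by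
  obtain ⟨h1, h2, h3, h4⟩ := quarterTurn_coin_bundlesAt u σ h hj
  rw [sum_bundlesAt (fun b => f (σ (b.1, b.2, j))), sum_bundlesAt (fun b => f (b.1, b.2, j))]
  simp only [h1, h2, h3, h4]
  ring

/-- The same for the inverse coin permutation. -/
theorem sum_bundlesAt_quarterTurn_coin_symm (u : Site 2) (σ : Coin ≃ Coin)
    (h : ∀ (t : Site 2) (d : Fin 2) (j : Fin 3), j ≠ 0 → σ (t, d, j) =
      (![t 1 - u 1 + u 0, u 0 + u 1 - t 0 - (if d = 0 then 1 else 0)], Equiv.swap 0 1 d, j))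
    {j : Fin 3} (hj : j ≠ 0) (f : Coin → ℝ) :
    ∑ b ∈ bundlesAt u, f (σ.symm (b.1, b.2, j)) = ∑ b ∈ bundlesAt u, f (b.1, b.2, j) := by
  have h' := sum_bundlesAt_quarterTurn_coin u σ h hj (fun i => f (σ.symm i))
  simp only [Equiv.symm_apply_apply] at h'
  exact h'.symm

/-! ### … and the interior edges of the cells at `u` -/

/-- `⌊-x/m⌋ = -⌊x/m⌋ - 1` when `m ∤ x` (`m > 0`). -/
theorem neg_ediv_eq_of_not_dvd (x : ℤ) {m : ℤ} (hm : 0 < m) (hx : ¬ m ∣ x) :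
    -x / m = -(x / m) - 1 := by
  have hq := (Int.ediv_eq_iff_of_pos hm).1 (rfl : x / m = x / m)
  have hne : x / m * m ≠ x := fun h' => hx ⟨x / m, by rw [mul_comm] at h'; exact h'.symm⟩
  have hlt : x / m * m < x := lt_of_le_of_ne hq.1 hne
  rw [Int.ediv_eq_iff_of_pos hm]
  constructor <;> nlinarith

/-- The own-coin part of the coin permutation stays in layer `0`. -/
theorem quarterTurn_coin_zero_eq {k : ℕ} {u : Site 2} (σ : Coin ≃ Coin)
    (h0 : ∀ (v : Site 2) (d : Fin 2), σ (v, d, 0) =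
      (![v 1 - ctr k u 1 + ctr k u 0, ctr k u 0 + ctr k u 1 - v 0 - (if d = 0 then 1 else 0)],
        Equiv.swap 0 1 d, 0)) (e : Site 2 × Fin 2) :
    σ (e.1, e.2, 0) = ((σ (e.1, e.2, 0)).1, (σ (e.1, e.2, 0)).2.1, 0) := by
  rw [h0]

/-- The edge part `e ↦ edge of σ (e, 0)` of the coin permutation is injective. -/
theorem quarterTurn_edge_injective {k : ℕ} {u : Site 2} (σ : Coin ≃ Coin)
    (h0 : ∀ (v : Site 2) (d : Fin 2), σ (v, d, 0) =
      (![v 1 - ctr k u 1 + ctr k u 0, ctr k u 0 + ctr k u 1 - v 0 - (if d = 0 then 1 else 0)],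
        Equiv.swap 0 1 d, 0)) :
    Function.Injective fun e : Site 2 × Fin 2 => ((σ (e.1, e.2, 0)).1, (σ (e.1, e.2, 0)).2.1) := by
  intro e e' hee'
  have h1 : σ (e.1, e.2, 0) = σ (e'.1, e'.2, 0) := by
    rw [quarterTurn_coin_zero_eq σ h0 e, quarterTurn_coin_zero_eq σ h0 e']
    simp only [Prod.mk.injEq] at hee'
    rw [hee'.1, hee'.2]
  have h2 := σ.injective h1
  simp only [Prod.mk.injEq, and_true] at h2
  exact Prod.ext h2.1 h2.2

/-- The edge part of the coin permutation preserves axiality. -/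
theorem ax_quarterTurn_edge_iff {k : ℕ} {u : Site 2} (σ : Coin ≃ Coin)
    (h0 : ∀ (v : Site 2) (d : Fin 2), σ (v, d, 0) =
      (![v 1 - ctr k u 1 + ctr k u 0, ctr k u 0 + ctr k u 1 - v 0 - (if d = 0 then 1 else 0)],
        Equiv.swap 0 1 d, 0)) (e : Site 2 × Fin 2) :
    ax k ((σ (e.1, e.2, 0)).1, (σ (e.1, e.2, 0)).2.1) ↔ ax k e := by
  obtain ⟨v, d⟩ := e
  rw [h0]
  fin_cases d
  · simp only [ax, ctr_apply, Fin.zero_eta, Fin.isValue, ↓reduceIte, Equiv.swap_apply_left,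
      one_ne_zero, Matrix.cons_val_zero]
    rw [dvd_add_left (dvd_mul_right _ _), dvd_sub_left (dvd_mul_right _ _)]
  · simp only [ax, ctr_apply, Fin.mk_one, Fin.isValue, one_ne_zero, ↓reduceIte, sub_zero,
      Equiv.swap_apply_right, Matrix.cons_val_one, Matrix.cons_val_fin_one]
    rw [dvd_sub_right (dvd_add (dvd_mul_right _ _) (dvd_mul_right _ _))]

/-- **An interior edge of the cell `t` goes to an interior edge of the rotated cell**: for a
non-axial `e`, the coarse base of the edge of `σ (e, 0)` is `(t₁ − u₁ + u₀, u₀ + u₁ − t₀ − 1)`,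
`t = tb k e` (`k > 0`). -/
theorem tb_quarterTurn_edge {k : ℕ} (hk : 0 < k) {u : Site 2} (σ : Coin ≃ Coin)
    (h0 : ∀ (v : Site 2) (d : Fin 2), σ (v, d, 0) =
      (![v 1 - ctr k u 1 + ctr k u 0, ctr k u 0 + ctr k u 1 - v 0 - (if d = 0 then 1 else 0)],
        Equiv.swap 0 1 d, 0)) {e : Site 2 × Fin 2} (he : ¬ ax k e) :
    tb k ((σ (e.1, e.2, 0)).1, (σ (e.1, e.2, 0)).2.1) =
      ![tb k e 1 - u 1 + u 0, u 0 + u 1 - tb k e 0 - 1] := by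
  obtain ⟨v, d⟩ := e
  have hk' : (0 : ℤ) < k := by exact_mod_cast hk
  have hA : (v 1 - ctr k u 1 + ctr k u 0) / (k : ℤ) = v 1 / k - u 1 + u 0 := by
    rw [ctr_apply, ctr_apply, show v 1 - (k : ℤ) * u 1 + k * u 0 = v 1 + k * (u 0 - u 1) by ring,
      Int.add_mul_ediv_left _ _ hk'.ne']
    ring
  rw [h0]
  funext i
  fin_cases d
  · have hB : (ctr k u 0 + ctr k u 1 - v 0 - 1) / (k : ℤ) = u 0 + u 1 - v 0 / k - 1 := by
      rw [ctr_apply, ctr_apply,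
        show (k : ℤ) * u 0 + k * u 1 - v 0 - 1 = (-v 0 - 1) + k * (u 0 + u 1) by ring,
        Int.add_mul_ediv_left _ _ hk'.ne',
        Literature.NumberTheory.Transcendental.Int.neg_sub_one_ediv_eq _ hk']
      ring
    fin_cases i
    · simpa [tb] using hA
    · simpa [tb] using hB
  · have hv : ¬ (k : ℤ) ∣ v 0 := by simpa [ax] using he
    have hB : (ctr k u 0 + ctr k u 1 - v 0) / (k : ℤ) = u 0 + u 1 - v 0 / k - 1 := by
      rw [ctr_apply, ctr_apply,
        show (k : ℤ) * u 0 + k * u 1 - v 0 = -v 0 + k * (u 0 + u 1) by ring,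
        Int.add_mul_ediv_left _ _ hk'.ne', neg_ediv_eq_of_not_dvd _ hk' hv]
      ring
    fin_cases i
    · simpa [tb] using hA
    · simpa [tb] using hB

/-- The four cells at `u`, coordinatewise: `t ∈ cellsAt u ↔ tᵢ ∈ {uᵢ, uᵢ − 1}` for `i = 0, 1`. -/
theorem mem_cellsAt_iff (u t : Site 2) :
    t ∈ cellsAt u ↔ (t 0 = u 0 ∨ t 0 = u 0 - 1) ∧ (t 1 = u 1 ∨ t 1 = u 1 - 1) := by
  simp only [cellsAt, Finset.mem_insert, Finset.mem_singleton]
  constructor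
  · rintro (rfl | rfl | rfl | rfl) <;> simp
  · rintro ⟨h0 | h0, h1 | h1⟩
    · exact Or.inl (funext fun i => by fin_cases i <;> simp [h0, h1])
    · exact Or.inr (Or.inr (Or.inl (funext fun i => by fin_cases i <;> simp [h0, h1])))
    · exact Or.inr (Or.inl (funext fun i => by fin_cases i <;> simp [h0, h1]))
    · exact Or.inr (Or.inr (Or.inr (funext fun i => by fin_cases i <;> simp [h0, h1])))

/-- The rotated cell of a cell at `u` is a cell at `u`. -/
theorem quarterTurn_cell_mem_cellsAt (u : Site 2) {t : Site 2} (ht : t ∈ cellsAt u) :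
    (![t 1 - u 1 + u 0, u 0 + u 1 - t 0 - 1] : Site 2) ∈ cellsAt u := by
  rw [mem_cellsAt_iff] at ht ⊢
  simp only [Matrix.cons_val_zero, Matrix.cons_val_one, Matrix.cons_val_fin_one]
  omega

/-- The edge part of the coin permutation maps the interior edges of the cells at `u` into
themselves (`k > 0`). -/
theorem quarterTurn_edge_mem_interior {k : ℕ} (hk : 0 < k) (u : Site 2) (σ : Coin ≃ Coin)
    (h0 : ∀ (v : Site 2) (d : Fin 2), σ (v, d, 0) =
      (![v 1 - ctr k u 1 + ctr k u 0, ctr k u 0 + ctr k u 1 - v 0 - (if d = 0 then 1 else 0)],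
        Equiv.swap 0 1 d, 0)) {t : Site 2} (ht : t ∈ cellsAt u) {e : Site 2 × Fin 2}
    (he : e ∈ interiorEdges k t) :
    ((σ (e.1, e.2, 0)).1, (σ (e.1, e.2, 0)).2.1) ∈ (cellsAt u).biUnion (interiorEdges k) := by
  have hax : ¬ ax k e := by
    unfold interiorEdges at he
    exact (Finset.mem_filter.1 he).2
  have htb : tb k e = t := tb_eq_of_mem_interiorEdges hk he
  have hax' : ¬ ax k ((σ (e.1, e.2, 0)).1, (σ (e.1, e.2, 0)).2.1) := by
    rwa [ax_quarterTurn_edge_iff σ h0]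
  refine Finset.mem_biUnion.2 ⟨_, ?_, mem_interiorEdges_tb hk hax'⟩
  rw [tb_quarterTurn_edge hk σ h0 hax, htb]
  exact quarterTurn_cell_mem_cellsAt u ht

/-- **The edge part of the coin permutation of the quarter turn permutes the interior edges of
the four cells at `u`** (`k > 0`). -/
theorem image_quarterTurn_interior {k : ℕ} (hk : 0 < k) (u : Site 2) (σ : Coin ≃ Coin)
    (h0 : ∀ (v : Site 2) (d : Fin 2), σ (v, d, 0) =
      (![v 1 - ctr k u 1 + ctr k u 0, ctr k u 0 + ctr k u 1 - v 0 - (if d = 0 then 1 else 0)],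
        Equiv.swap 0 1 d, 0)) :
    ((cellsAt u).biUnion (interiorEdges k)).image
        (fun e : Site 2 × Fin 2 => ((σ (e.1, e.2, 0)).1, (σ (e.1, e.2, 0)).2.1)) =
      (cellsAt u).biUnion (interiorEdges k) := by
  refine Finset.eq_of_subset_of_card_le (fun e' he' => ?_) ?_
  · obtain ⟨e, he, rfl⟩ := Finset.mem_image.1 he'
    obtain ⟨t, ht, het⟩ := Finset.mem_biUnion.1 he
    exact quarterTurn_edge_mem_interior hk u σ h0 ht het
  · rw [Finset.card_image_of_injective _ (quarterTurn_edge_injective σ h0)]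

/-- **Double sums over the interior edges of the cells at `u` are invariant under the coin
permutation of the quarter turn** (own coins, layer `0`; `k > 0`). -/
theorem sum_interiorEdges_quarterTurn_coin {k : ℕ} (hk : 0 < k) (u : Site 2) (σ : Coin ≃ Coin)
    (h0 : ∀ (v : Site 2) (d : Fin 2), σ (v, d, 0) =
      (![v 1 - ctr k u 1 + ctr k u 0, ctr k u 0 + ctr k u 1 - v 0 - (if d = 0 then 1 else 0)],
        Equiv.swap 0 1 d, 0)) (f : Coin → ℝ) :
    ∑ t ∈ cellsAt u, ∑ e ∈ interiorEdges k t, f (σ (e.1, e.2, 0)) =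
      ∑ t ∈ cellsAt u, ∑ e ∈ interiorEdges k t, f (e.1, e.2, 0) := by
  have hdisj := pairwiseDisjoint_interiorEdges hk (cellsAt u)
  have h1 : ∑ t ∈ cellsAt u, ∑ e ∈ interiorEdges k t, f (σ (e.1, e.2, 0)) =
      ∑ e ∈ (cellsAt u).biUnion (interiorEdges k), f (σ (e.1, e.2, 0)) :=
    (Finset.sum_biUnion hdisj).symm
  have h2 : ∑ t ∈ cellsAt u, ∑ e ∈ interiorEdges k t, f (e.1, e.2, 0) =
      ∑ e ∈ (cellsAt u).biUnion (interiorEdges k), f (e.1, e.2, 0) :=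
    (Finset.sum_biUnion hdisj).symm
  have h3 : ∑ e' ∈ ((cellsAt u).biUnion (interiorEdges k)).image
        (fun e : Site 2 × Fin 2 => ((σ (e.1, e.2, 0)).1, (σ (e.1, e.2, 0)).2.1)), f (e'.1, e'.2, 0) =
      ∑ e ∈ (cellsAt u).biUnion (interiorEdges k),
        f (((σ (e.1, e.2, 0)).1, (σ (e.1, e.2, 0)).2.1).1,
          ((σ (e.1, e.2, 0)).1, (σ (e.1, e.2, 0)).2.1).2, 0) :=
    Finset.sum_image fun e _ e' _ hee' => quarterTurn_edge_injective σ h0 hee'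
  rw [image_quarterTurn_interior hk u σ h0] at h3
  rw [h1, h2, h3]
  exact Finset.sum_congr rfl fun e _ => by rw [← quarterTurn_coin_zero_eq σ h0 e]

/-- The same for the inverse coin permutation. -/
theorem sum_interiorEdges_quarterTurn_coin_symm {k : ℕ} (hk : 0 < k) (u : Site 2)
    (σ : Coin ≃ Coin)
    (h0 : ∀ (v : Site 2) (d : Fin 2), σ (v, d, 0) =
      (![v 1 - ctr k u 1 + ctr k u 0, ctr k u 0 + ctr k u 1 - v 0 - (if d = 0 then 1 else 0)],
        Equiv.swap 0 1 d, 0)) (f : Coin → ℝ) :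
    ∑ t ∈ cellsAt u, ∑ e ∈ interiorEdges k t, f (σ.symm (e.1, e.2, 0)) =
      ∑ t ∈ cellsAt u, ∑ e ∈ interiorEdges k t, f (e.1, e.2, 0) := by
  have h' := sum_interiorEdges_quarterTurn_coin hk u σ h0 (fun i => f (σ.symm i))
  simp only [Equiv.symm_apply_apply] at h'
  exact h'.symm

/-! ### The orbit sums of the influences are `C₄(u)`-invariant -/

/-- **`Tρ`-type orbit sums are invariant** (general intertwined bias-preserving pair whose coin
permutation acts on the bundles at `u` as the quarter turn): the sum over `b ∈ bundlesAt u` of the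
signed influences of the selectors `(b, 2)` on the coin event of the rotated event equals that on
the coin event of the event. -/
theorem bundleSum_infl_pullback {k : ℕ} (q : ℝ × ℝ) (u : Site 2) {g : Site 2 ≃ Site 2}
    {σ : Coin ≃ Coin} (hcfg : ∀ S, BondConfig.relabel (sym2Equiv g) (cfg k S) = cfg k (σ ⁻¹' S))
    (hprm : ∀ i, prm k q.1 q.2 (σ i) = prm k q.1 q.2 i)
    (h : ∀ (t : Site 2) (d : Fin 2) (j : Fin 3), j ≠ 0 → σ (t, d, j) =
      (![t 1 - u 1 + u 0, u 0 + u 1 - t 0 - (if d = 0 then 1 else 0)], Equiv.swap 0 1 d, j))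
    (B : Set (BondConfig (Site 2))) :
    ∑ b ∈ bundlesAt u,
        ((coinLaw k q).real {S | insert (b.1, b.2, (2 : Fin 3)) S ∈
            cfg k ⁻¹' (BondConfig.relabel (sym2Equiv g) ⁻¹' B)} -
          (coinLaw k q).real {S | S \ {(b.1, b.2, (2 : Fin 3))} ∈
            cfg k ⁻¹' (BondConfig.relabel (sym2Equiv g) ⁻¹' B)}) =
      ∑ b ∈ bundlesAt u,
        ((coinLaw k q).real {S | insert (b.1, b.2, (2 : Fin 3)) S ∈ cfg k ⁻¹' B} -
          (coinLaw k q).real {S | S \ {(b.1, b.2, (2 : Fin 3))} ∈ cfg k ⁻¹' B}) := by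
  rw [Finset.sum_congr rfl fun b _ => infl_pullback_eq q hcfg hprm B _]
  exact sum_bundlesAt_quarterTurn_coin_symm u σ h (by decide)
    (fun i => (coinLaw k q).real {S | insert i S ∈ cfg k ⁻¹' B} -
      (coinLaw k q).real {S | S \ {i} ∈ cfg k ⁻¹' B})

/-- **`Tc`-type orbit sums are invariant** (same setting; own coins of the interior edges of the
cells at `u`; `k > 0`). -/
theorem cellSum_infl_pullback {k : ℕ} (hk : 0 < k) (q : ℝ × ℝ) (u : Site 2) {g : Site 2 ≃ Site 2}
    {σ : Coin ≃ Coin} (hcfg : ∀ S, BondConfig.relabel (sym2Equiv g) (cfg k S) = cfg k (σ ⁻¹' S))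
    (hprm : ∀ i, prm k q.1 q.2 (σ i) = prm k q.1 q.2 i)
    (h0 : ∀ (v : Site 2) (d : Fin 2), σ (v, d, 0) =
      (![v 1 - ctr k u 1 + ctr k u 0, ctr k u 0 + ctr k u 1 - v 0 - (if d = 0 then 1 else 0)],
        Equiv.swap 0 1 d, 0))
    (B : Set (BondConfig (Site 2))) :
    ∑ t ∈ cellsAt u, ∑ e ∈ interiorEdges k t,
        ((coinLaw k q).real {S | insert (e.1, e.2, (0 : Fin 3)) S ∈
            cfg k ⁻¹' (BondConfig.relabel (sym2Equiv g) ⁻¹' B)} -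
          (coinLaw k q).real {S | S \ {(e.1, e.2, (0 : Fin 3))} ∈
            cfg k ⁻¹' (BondConfig.relabel (sym2Equiv g) ⁻¹' B)}) =
      ∑ t ∈ cellsAt u, ∑ e ∈ interiorEdges k t,
        ((coinLaw k q).real {S | insert (e.1, e.2, (0 : Fin 3)) S ∈ cfg k ⁻¹' B} -
          (coinLaw k q).real {S | S \ {(e.1, e.2, (0 : Fin 3))} ∈ cfg k ⁻¹' B}) := by
  rw [Finset.sum_congr rfl fun t _ =>
    Finset.sum_congr rfl fun e _ => infl_pullback_eq q hcfg hprm B (e.1, e.2, (0 : Fin 3))]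
  exact sum_interiorEdges_quarterTurn_coin_symm hk u σ h0
    (fun i => (coinLaw k q).real {S | insert i S ∈ cfg k ⁻¹' B} -
      (coinLaw k q).real {S | S \ {i} ∈ cfg k ⁻¹' B})

/-- **The `Tρ`-type orbit sum at `u` is invariant under the quarter turn about `k•u`** (`k ≠ 0`,
`g x = (c₀ + c₁ − x₁, x₀ − c₀ + c₁)`, `c = ctr k u`, ANY event `B`): summed over the four bundles
`b` at `u`, the signed influences of the selectors `(b, 2)` on the coin event of `{ω | g '' ω ∈ B}`
and on that of `B` agree. -/
theorem bundleSum_infl_quarterTurn {k : ℕ} (hk : k ≠ 0) (q : ℝ × ℝ) (u : Site 2)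
    (g : Site 2 ≃ Site 2) (hg : ∀ x, g x = ![ctr k u 0 + ctr k u 1 - x 1, x 0 - ctr k u 0 + ctr k u 1])
    (B : Set (BondConfig (Site 2))) :
    ∑ b ∈ bundlesAt u,
        ((coinLaw k q).real {S | insert (b.1, b.2, (2 : Fin 3)) S ∈
            cfg k ⁻¹' (BondConfig.relabel (sym2Equiv g) ⁻¹' B)} -
          (coinLaw k q).real {S | S \ {(b.1, b.2, (2 : Fin 3))} ∈
            cfg k ⁻¹' (BondConfig.relabel (sym2Equiv g) ⁻¹' B)}) =
      ∑ b ∈ bundlesAt u,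
        ((coinLaw k q).real {S | insert (b.1, b.2, (2 : Fin 3)) S ∈ cfg k ⁻¹' B} -
          (coinLaw k q).real {S | S \ {(b.1, b.2, (2 : Fin 3))} ∈ cfg k ⁻¹' B}) := by
  obtain ⟨g', σ, hg', -, h, hcfg, hprm⟩ := exists_quarterTurn hk u
  obtain rfl : g = g' := quarterTurn_unique hg hg'
  exact bundleSum_infl_pullback q u hcfg (hprm q.1 q.2) h B

/-- **The `Tc`-type orbit sum at `u` is invariant under the quarter turn about `k•u`** (`k ≠ 0`,
ANY event `B`): summed over the interior edges `e` of the four cells at `u`, the signed influences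
of the own coins `(e, 0)` on the coin event of `{ω | g '' ω ∈ B}` and on that of `B` agree. -/
theorem cellSum_infl_quarterTurn {k : ℕ} (hk : k ≠ 0) (q : ℝ × ℝ) (u : Site 2)
    (g : Site 2 ≃ Site 2) (hg : ∀ x, g x = ![ctr k u 0 + ctr k u 1 - x 1, x 0 - ctr k u 0 + ctr k u 1])
    (B : Set (BondConfig (Site 2))) :
    ∑ t ∈ cellsAt u, ∑ e ∈ interiorEdges k t,
        ((coinLaw k q).real {S | insert (e.1, e.2, (0 : Fin 3)) S ∈
            cfg k ⁻¹' (BondConfig.relabel (sym2Equiv g) ⁻¹' B)} -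
          (coinLaw k q).real {S | S \ {(e.1, e.2, (0 : Fin 3))} ∈
            cfg k ⁻¹' (BondConfig.relabel (sym2Equiv g) ⁻¹' B)}) =
      ∑ t ∈ cellsAt u, ∑ e ∈ interiorEdges k t,
        ((coinLaw k q).real {S | insert (e.1, e.2, (0 : Fin 3)) S ∈ cfg k ⁻¹' B} -
          (coinLaw k q).real {S | S \ {(e.1, e.2, (0 : Fin 3))} ∈ cfg k ⁻¹' B}) := by
  obtain ⟨g', σ, hg', h0, -, hcfg, hprm⟩ := exists_quarterTurn hk u
  obtain rfl : g = g' := quarterTurn_unique hg hg'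
  exact cellSum_infl_pullback (Nat.pos_of_ne_zero hk) q u hcfg (hprm q.1 q.2) h0 B

end Summit.CriticalPhenomena.CardyFormulaZ2.Theorems.CardySelfRefinement.FarField

end
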